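import Summits.BirchSwinnertonDyer.BirchSwinnertonDyer.Theorems.EisensteinPrimesGoodLatticeResidualPairDeterminant
import Literature.NumberTheory.Automorphic.BCDTTheoremBWildAtThreeTwist
import Literature.NumberTheory.EllipticCurves.TateModuleTameDescentProofs
import Literature.NumberTheory.GaloisRepresentations.IntegralGaloisActionProofs
import Literature.NumberTheory.GaloisRepresentations.RatPlaceTwoProofs
import Summits.BirchSwinnertonDyer.Rank1Residual.WAll.TargetAdditiveAtThreeCells
import HarnessLib

/-!
# Route `CumulativeHeegnerLeopoldt`, crux K2 `EisensteinCharacterInvariantsAtThree` (stmt-BirchSwinnertonDyer-24199):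
# [LOC₃] — at `p = 3` one member of the Teichmüller pair of a rational `3`-line is UNRAMIFIED at `3` (helper)

Lead prover `bsd-line-chl-p1` g9 (`--supports 24199`). The character cut of K2
(`…OfCharacterCut` p614352, `…CharacterCutEq` p681722) displays the hypothesis [LOC₃]: for `E/ℚ` with `E[3]`
reducible, a rational `3`-line `Φ` and the Teichmüller lifts `θsub, θquot : G_ℚ → GL₁(ℤ₃)` of the characters of `G_ℚ`
on `Φ` and on `E[3]/Φ`, ONE of `θsub`, `θquot` is unramified at `3`. This file PROVES it (for every `E/ℚ` and every
rational `3`-line — the cell binders of the displayed hypothesis are idle). The argument is the local fact «the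
tame inertia group at `3` has a unique quadratic character»:

* both characters are quadratic (`θ² = 1`), so they kill the wild ramification groups `Γ_ℚ^u(𝔓)`, `u > 0`
  (their image is a `3`-group, `isPGroup_map_absUpperRamificationSubgroup`), and the image of the inertia group
  `I_𝔓` under `(θsub, θquot)` is CYCLIC (`exists_map_inertia_eq_zpowers_of_forall_absUpperRamificationSubgroup`,
  Serre IV §2 Cor. 1), generated by the image of one `s ∈ I_𝔓`;
* `θsub · θquot = ω̃` (the Teichmüller lift of the mod-`3` cyclotomic character: the Weil-pairing determinant of the
  residual pair, tree `entry_mul_entry_eq_teichmullerChar`) and `ω̃` is RAMIFIED at `3`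
  (`exists_mem_inertia_modPCyclotomicCharacterZMod_three_eq_neg_one`);
* hence exactly one of `θsub(s)`, `θquot(s)` is `1` (both `−1` would make `ω̃` trivial on `I_𝔓`), i.e. one of the
  two characters is trivial on `I_𝔓`; conjugating (`Ideal.inertia_smul`, `exists_smul_eq_of_mem_primesAbove`) the
  same member is trivial on every inertia group above `3`.

THEOREMS ONLY (the scalar character `det ∘ θ` is supplied by an existence theorem, no definition); no `sorry`; imports no
`Theses` module. BSD is not proved for any curve by any of this.
References: [SerreLocalFields1979] Ch. IV §2 Cor. 1 and Cor. 3 of Prop. 7; [NeukirchANT1999] Ch. I §9;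
[KellerYin2024] §1.1 («φψ = ω»), §1.4; [CastellaGrossiLeeSkinner2022] §1.1 (p ∤ cond of one character).
-/

set_option autoImplicit false
-- `…BirchSwinnertonDyer.BirchSwinnertonDyer.Theorems…` is the problem's mandated namespace (D-0017).
set_option linter.dupNamespace false

noncomputable section

open scoped Classical Pointwise

namespace Summit.BirchSwinnertonDyer.BirchSwinnertonDyer.Theorems.EisensteinCharacterInvariantsAtThreeLocThree

open WeierstrassCurve NumberField IsDedekindDomain Field
  Literature.NumberTheory.EllipticCurves Literature.NumberTheory.EllipticCurves.KellerYin2024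
  Literature.NumberTheory.EllipticCurves.Rank1Residual
  Literature.NumberTheory.GaloisRepresentations
  Summit.BirchSwinnertonDyer.BirchSwinnertonDyer.Theorems.EisensteinPrimesMuLambda

/-! ## §1 The scalar character `det ∘ θ : Γ → ℚ̄_pˣ` of a rank-one `𝓞`-representation -/

section Scalar

variable {F : Type} [Field F] {p : ℕ} [Fact p.Prime] (S : Set (PadicAlgCl p))

/-- **The scalar character of `θ : Γ_F → GL₁(𝓞)` exists**: a homomorphism `ψ : Γ_F → ℚ̄_pˣ` whose value is the entry
of `θ σ` read in `ℚ̄_p` (namely `det ∘ θ` pushed along `𝓞 ⊂ ℚ̄_p`), continuous as a `ℚ̄_p`-valued function.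
Stated as an existence theorem (no new definition). [folklore] -/
theorem exists_scalarChar (θ : FramedGaloisRep F (padicCoeffIntegers S) 1) :
    ∃ ψ : absoluteGaloisGroup F →* (PadicAlgCl p)ˣ,
      (∀ σ, ((ψ σ : (PadicAlgCl p)ˣ) : PadicAlgCl p) = ((entry S θ σ : padicCoeffIntegers S) : PadicAlgCl p)) ∧
        Continuous fun σ ↦ ((ψ σ : (PadicAlgCl p)ˣ) : PadicAlgCl p) := by
  let ψ : absoluteGaloisGroup F →* (PadicAlgCl p)ˣ :=
    (Units.map ((padicCoeffIntegers S).subtype : padicCoeffIntegers S →* PadicAlgCl p)).comp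
      (Matrix.GeneralLinearGroup.det.comp θ.toMonoidHom)
  have hψ : ∀ σ, ((ψ σ : (PadicAlgCl p)ˣ) : PadicAlgCl p) = ((entry S θ σ : padicCoeffIntegers S) : PadicAlgCl p) :=
    fun σ ↦ by rw [entry_eq_det]; rfl
  refine ⟨ψ, hψ, ?_⟩
  have h : (fun σ ↦ ((ψ σ : (PadicAlgCl p)ˣ) : PadicAlgCl p)) =
      (fun x : padicCoeffIntegers S ↦ (x : PadicAlgCl p)) ∘
        (fun M : Matrix (Fin 1) (Fin 1) (padicCoeffIntegers S) ↦ M 0 0) ∘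
        (fun g : GL (Fin 1) (padicCoeffIntegers S) ↦ (g : Matrix (Fin 1) (Fin 1) (padicCoeffIntegers S))) ∘
        (fun σ ↦ θ σ) := by
    funext σ
    rw [hψ]
    rfl
  rw [h]
  exact continuous_subtype_val.comp <| ((continuous_apply 0).comp (continuous_apply 0)).comp <|
    Units.continuous_val.comp θ.continuous_toFun

variable {S}

/-- For a scalar character `ψ` of `θ` (values = entries): `ψ σ = 1 ↔ θ σ = 1`. [folklore] -/
theorem eq_one_iff_of_coe_eq_entry (θ : FramedGaloisRep F (padicCoeffIntegers S) 1)
    {ψ : absoluteGaloisGroup F →* (PadicAlgCl p)ˣ}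
    (hψ : ∀ σ, ((ψ σ : (PadicAlgCl p)ˣ) : PadicAlgCl p) = ((entry S θ σ : padicCoeffIntegers S) : PadicAlgCl p))
    (σ : absoluteGaloisGroup F) : ψ σ = 1 ↔ θ σ = 1 := by
  constructor
  · intro h
    apply apply_eq_one_of_entry_eq_one S θ σ
    have h' := congrArg (fun u : (PadicAlgCl p)ˣ ↦ (u : PadicAlgCl p)) h
    simp only [hψ, Units.val_one] at h'
    exact Subtype.ext h'
  · intro h
    apply Units.ext
    have he : entry S θ σ = 1 := by
      change ((θ σ : GL (Fin 1) (padicCoeffIntegers S)) : Matrix (Fin 1) (Fin 1) (padicCoeffIntegers S)) 0 0 = 1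
      rw [h, Units.val_one, Matrix.one_apply_eq]
    rw [hψ, he, OneMemClass.coe_one, Units.val_one]

/-- For a scalar character `ψ` of a `(p−1)`-torsion `θ`: `ψ^{p−1} = 1`. [folklore] -/
theorem pow_eq_one_of_coe_eq_entry (θ : FramedGaloisRep F (padicCoeffIntegers S) 1)
    {ψ : absoluteGaloisGroup F →* (PadicAlgCl p)ˣ}
    (hψ : ∀ σ, ((ψ σ : (PadicAlgCl p)ˣ) : PadicAlgCl p) = ((entry S θ σ : padicCoeffIntegers S) : PadicAlgCl p))
    (hθ : ∀ σ : absoluteGaloisGroup F, θ σ ^ (p - 1) = 1) (σ : absoluteGaloisGroup F) :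
    ψ σ ^ (p - 1) = 1 := by
  rw [← map_pow, (eq_one_iff_of_coe_eq_entry θ hψ (σ ^ (p - 1))).mpr (by rw [map_pow]; exact hθ σ)]

variable (S)

/-- A continuous `ℚ̄_p`-valued character with `ψⁿ = 1` has an OPEN kernel (its values are `n`-th roots of unity, a
finite set, so the kernel is a closed subgroup of finite index). Same argument as the tree's
`AbsTopI.isOpen_ker_of_pow_eq_one`, restated here to keep this file's imports inside number theory. [folklore] -/
theorem isOpen_ker_of_pow_eq_one {G : Type*} [Group G] [TopologicalSpace G] [IsTopologicalGroup G]
    (ψ : G →* (PadicAlgCl p)ˣ) (hψ : Continuous fun g ↦ (ψ g : PadicAlgCl p)) {n : ℕ} (hn : 0 < n)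
    (h : ∀ g, ψ g ^ n = 1) : IsOpen (ψ.ker : Set G) := by
  have hfin : (Set.range fun g ↦ (ψ g : PadicAlgCl p)).Finite := by
    refine (Polynomial.nthRoots n (1 : PadicAlgCl p)).toFinset.finite_toSet.subset ?_
    rintro _ ⟨g, rfl⟩
    simp only [Finset.mem_coe, Multiset.mem_toFinset, Polynomial.mem_nthRoots hn]
    have := congrArg (fun u : (PadicAlgCl p)ˣ ↦ (u : PadicAlgCl p)) (h g)
    simpa using this
  have hfin' : (Set.range ψ).Finite := by
    refine Set.Finite.of_finite_image ?_ (fun a _ b _ hab ↦ Units.ext hab)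
    rw [← Set.range_comp]
    exact hfin
  haveI : Finite ψ.range := by
    exact (show (ψ.range : Set (PadicAlgCl p)ˣ).Finite by rw [MonoidHom.coe_range]; exact hfin').to_subtype
  have hclosed : IsClosed (ψ.ker : Set G) := by
    have : (ψ.ker : Set G) = (fun g ↦ (ψ g : PadicAlgCl p)) ⁻¹' {1} := by
      ext g
      simp only [SetLike.mem_coe, MonoidHom.mem_ker, Set.mem_preimage, Set.mem_singleton_iff,
        Units.ext_iff, Units.val_one]
    rw [this]
    exact isClosed_singleton.preimage hψ
  haveI : ψ.ker.FiniteIndex := inferInstance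
  exact ψ.ker.isOpen_of_isClosed_of_finiteIndex hclosed

end Scalar

/-! ## §2 At a prime `𝔓 ∣ 3`: one member of the pair is trivial on the inertia group `I_𝔓` -/

section PerPrime

/-- `-1 ≠ 1` in `𝔽₃` (stated at top level so that `decide` sees a closed term). [folklore] -/
theorem neg_one_ne_one_zmod_three : (-1 : ZMod 3) ≠ 1 := by decide

variable (W : WeierstrassCurve ℚ) [W.IsElliptic]

/-- **One of `θsub`, `θquot` is trivial on `I_𝔓` (`𝔓` a prime of `\bar ℤ` above `3`).** For a rational `3`-line
`Φ ≤ E[3]` and the Teichmüller pair `(θsub, θquot)` of `G_ℚ` on `Φ`, `E[3]/Φ`: the image of `I_𝔓` under the pair of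
(quadratic, hence tame) scalar characters is cyclic, generated by the image of some `s ∈ I_𝔓`; since
`θsub θquot = ω̃` is non-trivial on `I_𝔓`, exactly one of `θsub(s)`, `θquot(s)` equals `1`, and that member is trivial
on all of `I_𝔓`. [cite: SerreLocalFields1979, Ch. IV §2 Cor. 1 and Cor. 3 of Prop. 7]
[cite: KellerYin2024, §1.1 (arXiv:2402.12781v2 TeX L441–450: "φψ = ω")] -/
theorem inertia_trivial_sub_or_quot {Φ : AddSubgroup (geomTorsion W ((3 : ℕ) : ℤ))} (hΦ : IsRationalLine W 3 Φ)
    {θsub θquot : FramedGaloisRep ℚ (padicCoeffIntegers (∅ : Set (PadicAlgCl 3))) 1}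
    (hsub : IsTeichmullerLiftOn (∅ : Set (PadicAlgCl 3)) (Φ.map (geomTorsion W ((3 : ℕ) : ℤ)).subtype) θsub)
    (hquot : IsTeichmullerLiftOnQuot (∅ : Set (PadicAlgCl 3)) (Φ.map (geomTorsion W ((3 : ℕ) : ℤ)).subtype)
      (geomTorsion W ((3 : ℕ) : ℤ)) θquot)
    {u : HeightOneSpectrum (𝓞 ℚ)} (hu : ((3 : ℕ) : 𝓞 ℚ) ∈ u.asIdeal)
    {𝔓 : Ideal (absIntegers (𝓞 ℚ) ℚ)} (h𝔓 : 𝔓 ∈ u.primesAbove) :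
    (∀ σ ∈ 𝔓.inertia (absoluteGaloisGroup ℚ), θsub σ = 1) ∨
      (∀ σ ∈ 𝔓.inertia (absoluteGaloisGroup ℚ), θquot σ = 1) := by
  haveI : Fact (Nat.Prime 3) := ⟨Nat.prime_three⟩
  haveI : NeZero ((3 : ℕ) : ℚ) := ⟨by norm_num⟩
  -- the line read in `E(ℚ̄)`
  have hcardΦ : Nat.card (Φ.map (geomTorsion W ((3 : ℕ) : ℤ)).subtype) = 3 := by
    rw [Nat.card_congr (Φ.equivMapOfInjective (geomTorsion W ((3 : ℕ) : ℤ)).subtype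
      (geomTorsion W ((3 : ℕ) : ℤ)).subtype_injective).toEquiv.symm, hΦ.1]
  have hleΦ : Φ.map (geomTorsion W ((3 : ℕ) : ℤ)).subtype ≤ geomTorsion W ((3 : ℕ) : ℤ) := by
    rintro P ⟨Q, -, rfl⟩
    exact Q.2
  -- the scalar characters; they are quadratic
  obtain ⟨ψs, hψs, hcs⟩ := exists_scalarChar (∅ : Set (PadicAlgCl 3)) θsub
  obtain ⟨ψq, hψq, hcq⟩ := exists_scalarChar (∅ : Set (PadicAlgCl 3)) θquot
  have hs2 : ∀ g, ψs g ^ (3 - 1) = 1 := fun g ↦ pow_eq_one_of_coe_eq_entry θsub hψs hsub.1 g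
  have hq2 : ∀ g, ψq g ^ (3 - 1) = 1 := fun g ↦ pow_eq_one_of_coe_eq_entry θquot hψq hquot.1 g
  have hOs := isOpen_ker_of_pow_eq_one ψs hcs (n := 3 - 1) (by norm_num) hs2
  have hOq := isOpen_ker_of_pow_eq_one ψq hcq (n := 3 - 1) (by norm_num) hq2
  -- the open normal subgroup `N = ker ψs ⊓ ker ψq` and the discrete quotient `Γ_ℚ / N`
  set N : Subgroup (absoluteGaloisGroup ℚ) := ψs.ker ⊓ ψq.ker with hNdef
  haveI hNn : N.Normal := Subgroup.normal_inf_normal ψs.ker ψq.ker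
  have hNopen : IsOpen (N : Set (absoluteGaloisGroup ℚ)) := hOs.inter hOq
  haveI : DiscreteTopology (absoluteGaloisGroup ℚ ⧸ N) := QuotientGroup.discreteTopology hNopen
  let f : absoluteGaloisGroup ℚ →ₜ* (absoluteGaloisGroup ℚ ⧸ N) :=
    ⟨QuotientGroup.mk' N, QuotientGroup.continuous_mk⟩
  have hfapply : ∀ σ, f σ = QuotientGroup.mk' N σ := fun σ ↦ rfl
  have hfker : ∀ σ, f σ = 1 ↔ ψs σ = 1 ∧ ψq σ = 1 := fun σ ↦ by
    rw [hfapply, QuotientGroup.mk'_apply, QuotientGroup.eq_one_iff, hNdef, Subgroup.mem_inf, MonoidHom.mem_ker,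
      MonoidHom.mem_ker]
  -- every element of the image is `2`-torsion
  have hsq : ∀ σ, f σ ^ (3 - 1) = 1 := fun σ ↦ by
    rw [← map_pow, hfker]
    exact ⟨by rw [map_pow]; exact hs2 σ, by rw [map_pow]; exact hq2 σ⟩
  -- `f` kills the wild ramification groups (their image is a `3`-group of exponent `2`)
  have hwild : ∀ t : ℝ, 0 < t → ∀ σ ∈ absUpperRamificationSubgroup (𝓞 ℚ) 𝔓 t, f σ = 1 := by
    intro t ht σ hσ
    have hP := Literature.NumberTheory.GaloisRepresentations.isPGroup_map_absUpperRamificationSubgroup h𝔓 hu ht f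
    obtain ⟨k, hk⟩ := hP ⟨f σ, Subgroup.mem_map_of_mem f.toMonoidHom hσ⟩
    have hk' : f σ ^ 3 ^ k = 1 := by
      have := congrArg Subtype.val hk
      rw [Subgroup.coe_pow, Subgroup.coe_one] at this
      exact this
    exact Monoid.eq_one_of_pow_eq_one_of_coprime (hsq σ) hk' (Nat.Coprime.pow_right k (by norm_num))
  -- tame inertia is cyclic: the image of `I_𝔓` is generated by `f s`
  obtain ⟨s, hsI, hgen⟩ := exists_map_inertia_eq_zpowers_of_forall_absUpperRamificationSubgroup h𝔓 f hwild
  have hpow : ∀ σ ∈ 𝔓.inertia (absoluteGaloisGroup ℚ), ∃ k : ℤ, ψs σ = ψs s ^ k ∧ ψq σ = ψq s ^ k := by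
    intro σ hσ
    have hmem : f σ ∈ (𝔓.inertia (absoluteGaloisGroup ℚ)).map f.toMonoidHom := Subgroup.mem_map_of_mem _ hσ
    rw [hgen, Subgroup.mem_zpowers_iff] at hmem
    obtain ⟨k, hk⟩ := hmem
    have hone : f ((s ^ k)⁻¹ * σ) = 1 := by
      rw [map_mul, map_inv, map_zpow]
      change (f s ^ k)⁻¹ * f σ = 1
      rw [hk, inv_mul_cancel]
    obtain ⟨h1, h2⟩ := (hfker _).mp hone
    rw [map_mul, map_inv, map_zpow, inv_mul_eq_one] at h1 h2
    exact ⟨k, h1.symm, h2.symm⟩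
  -- case analysis on the generator
  by_cases hs1 : ψs s = 1
  · left
    intro σ hσ
    obtain ⟨k, hk, -⟩ := hpow σ hσ
    rw [hs1, one_zpow] at hk
    exact (eq_one_iff_of_coe_eq_entry θsub hψs σ).mp hk
  by_cases hq1 : ψq s = 1
  · right
    intro σ hσ
    obtain ⟨k, -, hk⟩ := hpow σ hσ
    rw [hq1, one_zpow] at hk
    exact (eq_one_iff_of_coe_eq_entry θquot hψq σ).mp hk
  exfalso
  -- both generator values are `-1`, so `ψs ψq` is trivial on `I_𝔓`
  have hval : ∀ {x : (PadicAlgCl 3)ˣ}, x ^ (3 - 1) = 1 → x ≠ 1 → (x : PadicAlgCl 3) = -1 := by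
    intro x hx hx1
    have h2 : (x : PadicAlgCl 3) * (x : PadicAlgCl 3) = 1 := by
      rw [← Units.val_mul, ← sq, show (2 : ℕ) = 3 - 1 from rfl, hx, Units.val_one]
    rcases mul_self_eq_one_iff.mp h2 with h | h
    · exact absurd (Units.ext (by rw [h, Units.val_one])) hx1
    · exact h
  have hsm : (ψs s : PadicAlgCl 3) = -1 := hval (hs2 s) hs1
  have hqm : (ψq s : PadicAlgCl 3) = -1 := hval (hq2 s) hq1
  have hprod1 : ψs s * ψq s = 1 := Units.ext (by rw [Units.val_mul, hsm, hqm, Units.val_one]; norm_num)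
  have hprod : ∀ σ ∈ 𝔓.inertia (absoluteGaloisGroup ℚ), (ψs σ : PadicAlgCl 3) * (ψq σ : PadicAlgCl 3) = 1 := by
    intro σ hσ
    obtain ⟨k, h1, h2⟩ := hpow σ hσ
    rw [h1, h2, ← Units.val_mul, ← mul_zpow, hprod1, one_zpow, Units.val_one]
  -- but `θsub θquot = ω̃` is ramified at `3`
  obtain ⟨τ, hτI, hτ⟩ := exists_mem_inertia_modPCyclotomicCharacterZMod_three_eq_neg_one hu h𝔓
  have hdet := entry_mul_entry_eq_teichmullerChar W (∅ : Set (PadicAlgCl 3)) hcardΦ hleΦ hsub hquot τ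
  rw [← hψs, ← hψq, hprod τ hτI, hτ] at hdet
  -- `ω(-1) = 1` in `ℚ̄₃`, hence in `ℤ₃`, hence `-1 = 1` in `𝔽₃`
  have h1 : ((Kato2004.teichmullerChar 3 (-1) : ℤ_[3]ˣ) : ℤ_[3]) = 1 := by
    have h := (algebraMap ℚ_[3] (PadicAlgCl 3)).injective (hdet.symm.trans (map_one _).symm)
    apply Subtype.val_injective
    rw [PadicInt.coe_one]
    exact h
  have h2 : ((-1 : (ZMod 3)ˣ) : ZMod 3) = 1 := by
    rw [← Kato2004.toZMod_teichmullerChar 3 (-1), h1, map_one]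
  rw [Units.val_neg, Units.val_one] at h2
  exact neg_one_ne_one_zmod_three h2

end PerPrime

/-! ## §3 [LOC₃]: one member of the pair is unramified at `3` -/

/-- **[LOC₃] — at `p = 3` one member of the Teichmüller pair of a rational `3`-line is UNRAMIFIED at `3`.** VERBATIM
the displayed hypothesis `hloc` of `EisensteinCharacterInvariantsAtThreeCharacterCut.unitCoeffLe_odd_of_characterCut`
(p614352) and of `EisensteinCharacterInvariantsAtThreeCharacterCutEq.lambda_eq_of_characterCut` (p681722): for `E/ℚ`
globally minimal of class O6 at `3` with `E[3]` reducible and a non-anomalous rational line (these cell binders are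
idle), every rational `3`-line `Φ` and Teichmüller lifts `θsub`, `θquot` of the characters of `G_ℚ` on `Φ` and on
`E[3]/Φ`: `θsub` is unramified at (every place above) `3` OR `θquot` is. Proof: §2 at one prime `𝔓₀ ∣ 3`, then
conjugation — the place of `ℚ` above `3` is unique (`v = (3)`), the primes of `\bar ℤ` above it are `Γ_ℚ`-conjugate
(`exists_smul_eq_of_mem_primesAbove`) and `I_{τ𝔓} = τ I_𝔓 τ⁻¹` (`Ideal.inertia_smul`).
[cite: SerreLocalFields1979, Ch. IV §2 Cor. 1 of Prop. 7] [cite: NeukirchANT1999, Ch. I §9 (9.4)–(9.6)]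
[cite: CastellaGrossiLeeSkinner2022, §1.1 (one of φ, ψ has conductor prime to p)] -/
theorem isUnramifiedAt_three_sub_or_quot :
    ∀ (W : WeierstrassCurve ℚ) [W.IsElliptic] [W.IsGloballyMinimal], Summit.BirchSwinnertonDyer.Rank1Residual.Additive.ClassO6 W 3 → Literature.NumberTheory.EllipticCurves.Rank1Residual.Red W 3 → (∃ Φ : AddSubgroup (WeierstrassCurve.geomTorsion W ((3 : ℕ) : ℤ)), Literature.NumberTheory.EllipticCurves.Rank1Residual.IsRationalLine W 3 Φ ∧ ∀ (v : IsDedekindDomain.HeightOneSpectrum (NumberField.RingOfIntegers ℚ)), ((3 : ℕ) : NumberField.RingOfIntegers ℚ) ∈ v.asIdeal → ∀ 𝔓 ∈ v.primesAbove, ¬ (∀ g ∈ 𝔓.decompositionSubgroup (Field.absoluteGaloisGroup ℚ), ∀ P ∈ Φ, g • P = P) ∧ ¬ (∀ g ∈ 𝔓.decompositionSubgroup (Field.absoluteGaloisGroup ℚ), ∀ P : WeierstrassCurve.geomTorsion W ((3 : ℕ) : ℤ), g • P - P ∈ Φ)) → ∀ (Φ : AddSubgroup (WeierstrassCurve.geomTorsion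 W ((3 : ℕ) : ℤ))), Literature.NumberTheory.EllipticCurves.Rank1Residual.IsRationalLine W 3 Φ → ∀ (θsub θquot : FramedGaloisRep ℚ (padicCoeffIntegers (∅ : Set (PadicAlgCl 3))) 1), Literature.NumberTheory.EllipticCurves.KellerYin2024.IsTeichmullerLiftOn (∅ : Set (PadicAlgCl 3)) (Φ.map (WeierstrassCurve.geomTorsion W ((3 : ℕ) : ℤ)).subtype) θsub → Literature.NumberTheory.EllipticCurves.KellerYin2024.IsTeichmullerLiftOnQuot (∅ : Set (PadicAlgCl 3)) (Φ.map (WeierstrassCurve.geomTorsion W ((3 : ℕ) : ℤ)).subtype) (WeierstrassCurve.geomTorsion W ((3 : ℕ) : ℤ)) θquot → (∀ u : IsDedekindDomain.HeightOneSpectrum (NumberField.RingOfIntegers ℚ), ((3 : ℕ) : NumberField.RingOfIntegers ℚ) ∈ u.asIdeal → θsub.IsUnramifiedAt u) ∨ (∀ u : IsDedekindDomain.HeightOneSpectrum (NumberField.RingOfIntegers ℚ), ((3 : ℕ) : NumberField.RingOfIntegers ℚ) ∈ u.asIdeal → θquot.IsUnramifiedAt u) := by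
  intro W _ _ _hO6 _hRed _hcell Φ hΦ θsub θquot hsub hquot
  haveI : Fact (Nat.Prime 3) := ⟨Nat.prime_three⟩
  by_cases h : ∀ u : HeightOneSpectrum (𝓞 ℚ), ((3 : ℕ) : 𝓞 ℚ) ∈ u.asIdeal → θsub.IsUnramifiedAt u
  · exact Or.inl h
  right
  push Not at h
  obtain ⟨u₀, hu₀, hnot⟩ := h
  have hex : ∃ 𝔓₀ ∈ u₀.primesAbove, ¬ ∀ σ ∈ 𝔓₀.inertia (absoluteGaloisGroup ℚ), θsub σ = 1 := by
    by_contra hc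
    push Not at hc
    exact hnot fun 𝔓 h𝔓 σ hσ ↦ hc 𝔓 h𝔓 σ hσ
  obtain ⟨𝔓₀, h𝔓₀, hsub₀⟩ := hex
  -- at `𝔓₀` the quotient character is trivial on inertia
  have hq₀ : ∀ σ ∈ 𝔓₀.inertia (absoluteGaloisGroup ℚ), θquot σ = 1 :=
    (inertia_trivial_sub_or_quot W hΦ hsub hquot hu₀ h𝔓₀).resolve_left hsub₀
  -- transport to every prime above `3`
  intro u hu 𝔓 h𝔓 σ hσ
  have huu : u = u₀ := HeightOneSpectrum.ext (by
    rw [Rat.asIdeal_eq_span_of_prime_mem u Nat.prime_three hu, Rat.asIdeal_eq_span_of_prime_mem u₀ Nat.prime_three hu₀])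
  subst huu
  obtain ⟨τ, hτ⟩ := HeightOneSpectrum.exists_smul_eq_of_mem_primesAbove_holds h𝔓₀ h𝔓
  rw [← hτ, Ideal.inertia_smul 𝔓₀ (absoluteGaloisGroup ℚ) τ, Subgroup.mem_smul_pointwise_iff_exists] at hσ
  obtain ⟨σ₀, hσ₀, rfl⟩ := hσ
  rw [MulAut.smul_def, MulAut.conj_apply, map_mul, map_mul, hq₀ σ₀ hσ₀, mul_one, map_inv, mul_inv_cancel]

end Summit.BirchSwinnertonDyer.BirchSwinnertonDyer.Theorems.EisensteinCharacterInvariantsAtThreeLocThree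

end
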